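import Mathlib
import Summits.PneNP.PneNP.Theorems.OverlapGapAlgebraSolvableImpliesStableSectionUnitClauseFMStep

/-!
# PneNP / OverlapGapAlgebra — crux `SolvableImpliesStableSection` (stmt-PneNP-2463):
# the UNIT CLAUSE block (11/·) — collisions and degenerate clauses

Support for crux `stmt-PneNP-2463` (`Summit.PneNP.PneNP.Theses.OverlapGapAlgebra.SolvableImpliesStableSection`),
registered stub `stub_lowDensity` (child G).  Kinds (B) and (C) of the violated clauses
(`sissU_violated_classify`).  (B) COLLISION: two slots of clause `i` holding distinct variables are
both set during round `t`.  Until then `i` has two unset slots, so it was never unit and the dynamics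
muting `i` agrees with the original; against it the content of `i` is a fresh clause and the event says
that two slots land on variables set during round `t`:
`#C·Σ_Φ 1[collision of i at round t] ≤ (k²-k)·Σ_Φ (2·New_Φ)²·#L^{k-2}` (`#L = 2n` literals), with
`New_Φ` counted in the dynamics muting `i`.  (C) DEGENERATE: two slots hold the same variable:
`#C·Σ_Φ 1[i degenerate] ≤ (k²-k)·2·#L^{k-1}·#Ω`.

* `sissU_sum_collision_indicator_le`, `sissU_card_degenerate_le`, `sissU_sum_degenerate_indicator_le`.
All objects are hypotheses; no definitions; axioms `propext`, `Classical.choice`, `Quot.sound`.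
-/

set_option linter.dupNamespace false -- `Summit.PneNP.PneNP.…`: summit = sub-problem (D-0017)

namespace Summit.PneNP.PneNP.Theorems

open Finset
open scoped Classical

section Collisions

variable {m k n : ℕ} {R : ℕ}

/-- **Collisions re-randomised.** For `i ∉ S` and a round `t`:
`#C·Σ_Φ 1[two slots of i with distinct variables, unset at t, set at t+1] ≤ (k²-k)·Σ_Φ (2New_Φ)²·#L^{k-2}`
where `New_Φ` counts the variables set during round `t` in the dynamics muting `i` as well. -/
theorem sissU_sum_collision_indicator_le
    (st : Finset (Fin m) → ℕ → (Fin m → Fin k → Fin n × Bool) → Fin n → Option Bool)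
    (dm : Finset (Fin m) → ℕ → (Fin m → Fin k → Fin n × Bool) → Fin n → Bool)
    (h0 : ∀ (S : Finset (Fin m)) (Φ : Fin m → Fin k → Fin n × Bool) (v : Fin n), st S 0 Φ v = none)
    (hstep : ∀ (S : Finset (Fin m)) (t : ℕ) (Φ : Fin m → Fin k → Fin n × Bool) (v : Fin n),
      st S (t + 1) Φ v =
        if st S t Φ v = none then
          (if ∃ i : Fin m, i ∉ S ∧ ∃ j : Fin k, (Φ i j).1 = v ∧ ∀ j' : Fin k, j' ≠ j →
              st S t Φ (Φ i j').1 ≠ none ∧ st S t Φ (Φ i j').1 ≠ some (Φ i j').2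
            then some (dm S t Φ v)
            else if (v : ℕ) * R / n = t then some true else none)
        else st S t Φ v)
    (hdm : ∀ (S : Finset (Fin m)) (t : ℕ) (Φ : Fin m → Fin k → Fin n × Bool) (v : Fin n) (i : Fin m)
      (j : Fin k), i ∉ S → (Φ i j).1 = v → st S t Φ v = none →
      (∀ j' : Fin k, j' ≠ j → st S t Φ (Φ i j').1 ≠ none ∧ st S t Φ (Φ i j').1 ≠ some (Φ i j').2) →
      (∀ i' : Fin m, i' ∉ S → (∃ j₁ : Fin k, (Φ i' j₁).1 = v ∧ ∀ j' : Fin k, j' ≠ j₁ →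
        st S t Φ (Φ i' j').1 ≠ none ∧ st S t Φ (Φ i' j').1 ≠ some (Φ i' j').2) → i ≤ i') →
      dm S t Φ v = (Φ i j).2)
    (S : Finset (Fin m)) (t : ℕ) (i : Fin m) (hi : i ∉ S) :
    (Fintype.card (Fin k → Fin n × Bool) : ℝ) *
      ∑ Φ : Fin m → Fin k → Fin n × Bool,
        (if ∃ j j' : Fin k, (Φ i j).1 ≠ (Φ i j').1 ∧ st S t Φ (Φ i j).1 = none ∧ st S t Φ (Φ i j').1 = none ∧
            st S (t + 1) Φ (Φ i j).1 ≠ none ∧ st S (t + 1) Φ (Φ i j').1 ≠ none then (1 : ℝ) else 0)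
      ≤ ((k * k - k : ℕ) : ℝ) * ∑ Φ : Fin m → Fin k → Fin n × Bool,
          ((((2 * ((univ : Finset (Fin n)).filter fun w => st (insert i S) t Φ w = none ∧
              st (insert i S) (t + 1) Φ w ≠ none).card) *
            (2 * ((univ : Finset (Fin n)).filter fun w => st (insert i S) t Φ w = none ∧
              st (insert i S) (t + 1) Φ w ≠ none).card) * (2 * n) ^ (k - 2)) : ℕ) : ℝ) := by
  have hiS : i ∈ insert i S := mem_insert_self i S
  set Rst : (Fin m → Fin k → Fin n × Bool) → ℕ → Fin n → Option Bool :=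
    fun Φ t' w => st (insert i S) t' Φ w with hRst
  have hR : ∀ (Φ : Fin m → Fin k → Fin n × Bool) (c : Fin k → Fin n × Bool),
      Rst (Function.update Φ i c) = Rst Φ := by
    intro Φ c
    funext t' w
    exact sissU_indep st dm h0 hstep hdm (insert i S) i hiS Φ c t' w
  set h : (Fin k → Fin n × Bool) → (ℕ → Fin n → Option Bool) → ℝ := fun x r =>
    if ∃ j j' : Fin k, (x j).1 ≠ (x j').1 ∧ r t (x j).1 = none ∧ r t (x j').1 = none ∧
        r (t + 1) (x j).1 ≠ none ∧ r (t + 1) (x j').1 ≠ none then (1 : ℝ) else 0 with hh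
  have hrr := Summit.PneNP.PneNP.Cruxes.SolvableImpliesStableSection.Sketch.stub_rerandomize i Rst hR h
  -- pointwise: the collision happens before `i` can be unit, so the mutings agree
  have hpt : ∀ Φ : Fin m → Fin k → Fin n × Bool,
      (if ∃ j j' : Fin k, (Φ i j).1 ≠ (Φ i j').1 ∧ st S t Φ (Φ i j).1 = none ∧ st S t Φ (Φ i j').1 = none ∧
          st S (t + 1) Φ (Φ i j).1 ≠ none ∧ st S (t + 1) Φ (Φ i j').1 ≠ none then (1 : ℝ) else 0)
        ≤ h (Φ i) (Rst Φ) := by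
    intro Φ
    have h01 : 0 ≤ h (Φ i) (Rst Φ) := by rw [hh]; dsimp only; split_ifs <;> norm_num
    split_ifs with hev
    · obtain ⟨j, j', hne, hj, hj', hj1, hj'1⟩ := hev
      have hagree : ∀ t' : ℕ, t' ≤ t + 1 → ∀ w : Fin n, st S t' Φ w = st (insert i S) t' Φ w := by
        refine sissU_agree st dm h0 hstep hdm S (insert i S) (subset_insert i S) Φ (t + 1) ?_
        intro t' ht' i₀ hi₀S' hi₀S w hw
        obtain rfl : i₀ = i := by
          rcases mem_insert.mp hi₀S' with h' | h'
          · exact h'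
          · exact absurd h' hi₀S
        obtain ⟨j₀, hj₀, hw0, hrest⟩ := hw
        -- slots `j` and `j'` are unset at round `t' ≤ t`, so both are the unit slot: contradiction
        have hjt' : st S t' Φ (Φ i₀ j).1 = none := sissU_st_none_anti st dm hstep S Φ _ t' t (by omega) hj
        have hj't' : st S t' Φ (Φ i₀ j').1 = none := sissU_st_none_anti st dm hstep S Φ _ t' t (by omega) hj'
        have e1 : j = j₀ := by
          by_contra hne1
          exact (hrest j hne1).1 hjt'
        have e2 : j' = j₀ := by
          by_contra hne2
          exact (hrest j' hne2).1 hj't'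
        exact hne (by rw [e1, e2])
      have hev' : ∃ j j' : Fin k, (Φ i j).1 ≠ (Φ i j').1 ∧ Rst Φ t (Φ i j).1 = none ∧ Rst Φ t (Φ i j').1 = none ∧
          Rst Φ (t + 1) (Φ i j).1 ≠ none ∧ Rst Φ (t + 1) (Φ i j').1 ≠ none := by
        refine ⟨j, j', hne, ?_, ?_, ?_, ?_⟩
        · show st (insert i S) t Φ (Φ i j).1 = none
          rw [← hagree t (Nat.le_succ t)]; exact hj
        · show st (insert i S) t Φ (Φ i j').1 = none
          rw [← hagree t (Nat.le_succ t)]; exact hj'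
        · show st (insert i S) (t + 1) Φ (Φ i j).1 ≠ none
          rw [← hagree (t + 1) le_rfl]; exact hj1
        · show st (insert i S) (t + 1) Φ (Φ i j').1 ≠ none
          rw [← hagree (t + 1) le_rfl]; exact hj'1
      have : h (Φ i) (Rst Φ) = 1 := by rw [hh]; exact if_pos hev'
      rw [this]
    · exact h01
  -- frozen count: two distinguished slots on new variables
  have hcount : ∀ Φ : Fin m → Fin k → Fin n × Bool, ∑ x : Fin k → Fin n × Bool, h x (Rst Φ) ≤
      ((k * k - k : ℕ) : ℝ) *
        ((((2 * ((univ : Finset (Fin n)).filter fun w => st (insert i S) t Φ w = none ∧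
            st (insert i S) (t + 1) Φ w ≠ none).card) *
          (2 * ((univ : Finset (Fin n)).filter fun w => st (insert i S) t Φ w = none ∧
            st (insert i S) (t + 1) Φ w ≠ none).card) * (2 * n) ^ (k - 2)) : ℕ) : ℝ) := by
    intro Φ
    set A : Finset (Fin n × Bool) := univ.filter fun ℓ =>
      ℓ.1 ∈ (univ : Finset (Fin n)).filter fun w => st (insert i S) t Φ w = none ∧
        st (insert i S) (t + 1) Φ w ≠ none with hA
    have hAcard : A.card = 2 * ((univ : Finset (Fin n)).filter fun w => st (insert i S) t Φ w = none ∧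
        st (insert i S) (t + 1) Φ w ≠ none).card := by rw [hA]; exact sissU_card_lit_on _
    have hsum : ∑ x : Fin k → Fin n × Bool, h x (Rst Φ) =
        (((univ : Finset (Fin k → Fin n × Bool)).filter fun x => ∃ j j' : Fin k, (x j).1 ≠ (x j').1 ∧
          Rst Φ t (x j).1 = none ∧ Rst Φ t (x j').1 = none ∧
          Rst Φ (t + 1) (x j).1 ≠ none ∧ Rst Φ (t + 1) (x j').1 ≠ none).card : ℝ) := by
      rw [hh]; simp only [sum_boole]
    have hsub : ((univ : Finset (Fin k → Fin n × Bool)).filter fun x => ∃ j j' : Fin k, (x j).1 ≠ (x j').1 ∧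
          Rst Φ t (x j).1 = none ∧ Rst Φ t (x j').1 = none ∧
          Rst Φ (t + 1) (x j).1 ≠ none ∧ Rst Φ (t + 1) (x j').1 ≠ none) ⊆
        (univ : Finset (Fin k)).offDiag.biUnion fun p =>
          Fintype.piFinset fun j'' : Fin k => if j'' = p.1 then A else if j'' = p.2 then A else univ := by
      intro x hx
      rw [mem_filter] at hx
      obtain ⟨-, j, j', hne, hj, hj', hj1, hj'1⟩ := hx
      have hjj' : j ≠ j' := fun e => hne (by rw [e])
      rw [mem_biUnion]
      refine ⟨(j, j'), by rw [mem_offDiag]; exact ⟨mem_univ _, mem_univ _, hjj'⟩, ?_⟩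
      rw [Fintype.mem_piFinset]
      intro j''
      dsimp only
      split_ifs with h1 h2
      · rw [hA, h1]; simp only [mem_filter, mem_univ, true_and]; exact ⟨hj, hj1⟩
      · rw [hA, h2]; simp only [mem_filter, mem_univ, true_and]; exact ⟨hj', hj'1⟩
      · exact mem_univ _
    have hcard : (((univ : Finset (Fin k → Fin n × Bool)).filter fun x => ∃ j j' : Fin k, (x j).1 ≠ (x j').1 ∧
          Rst Φ t (x j).1 = none ∧ Rst Φ t (x j').1 = none ∧
          Rst Φ (t + 1) (x j).1 ≠ none ∧ Rst Φ (t + 1) (x j').1 ≠ none).card)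
        ≤ (k * k - k) * (A.card * A.card * (univ : Finset (Fin n × Bool)).card ^ (k - 2)) := by
      refine (card_le_card hsub).trans (card_biUnion_le.trans (le_of_eq ?_))
      have hterm : ∀ p ∈ (univ : Finset (Fin k)).offDiag,
          (Fintype.piFinset fun j'' : Fin k => if j'' = p.1 then A else if j'' = p.2 then A else univ).card
            = A.card * A.card * (univ : Finset (Fin n × Bool)).card ^ (k - 2) := by
        intro p hp
        rw [mem_offDiag] at hp
        exact sissU_card_pi_two_slots p.1 p.2 hp.2.2 A A univ
      rw [sum_congr rfl hterm, sum_const, smul_eq_mul, offDiag_card, card_univ, Fintype.card_fin]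
    rw [hsum]
    have hL : (univ : Finset (Fin n × Bool)).card = 2 * n := by
      rw [card_univ, Fintype.card_prod, Fintype.card_fin, Fintype.card_bool, mul_comm]
    rw [hAcard, hL] at hcard
    exact_mod_cast hcard
  calc (Fintype.card (Fin k → Fin n × Bool) : ℝ) *
        ∑ Φ : Fin m → Fin k → Fin n × Bool,
          (if ∃ j j' : Fin k, (Φ i j).1 ≠ (Φ i j').1 ∧ st S t Φ (Φ i j).1 = none ∧ st S t Φ (Φ i j').1 = none ∧
              st S (t + 1) Φ (Φ i j).1 ≠ none ∧ st S (t + 1) Φ (Φ i j').1 ≠ none then (1 : ℝ) else 0)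
      ≤ (Fintype.card (Fin k → Fin n × Bool) : ℝ) * ∑ Φ : Fin m → Fin k → Fin n × Bool, h (Φ i) (Rst Φ) :=
        mul_le_mul_of_nonneg_left (sum_le_sum fun Φ _ => hpt Φ) (Nat.cast_nonneg _)
    _ = ∑ Φ : Fin m → Fin k → Fin n × Bool, ∑ x : Fin k → Fin n × Bool, h x (Rst Φ) := hrr
    _ ≤ ∑ Φ : Fin m → Fin k → Fin n × Bool, ((k * k - k : ℕ) : ℝ) *
        ((((2 * ((univ : Finset (Fin n)).filter fun w => st (insert i S) t Φ w = none ∧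
            st (insert i S) (t + 1) Φ w ≠ none).card) *
          (2 * ((univ : Finset (Fin n)).filter fun w => st (insert i S) t Φ w = none ∧
            st (insert i S) (t + 1) Φ w ≠ none).card) * (2 * n) ^ (k - 2)) : ℕ) : ℝ) :=
        sum_le_sum fun Φ _ => hcount Φ
    _ = _ := by rw [mul_sum]

/-- **Degenerate contents.** The contents with two distinct slots on the same variable number at most
`(k² - k)·(2·#L^{k-1})` (`#L = 2n`). -/
theorem sissU_card_degenerate_le (hn : 1 ≤ n) :
    ((univ : Finset (Fin k → Fin n × Bool)).filter fun x => ∃ j j' : Fin k, j ≠ j' ∧ (x j).1 = (x j').1).card ≤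
      (k * k - k) * (2 * (2 * n) ^ (k - 1)) := by
  set ℓ₀ : Fin n × Bool := (⟨0, hn⟩, true) with hℓ₀
  have hsub : ((univ : Finset (Fin k → Fin n × Bool)).filter fun x => ∃ j j' : Fin k, j ≠ j' ∧ (x j).1 = (x j').1) ⊆
      (univ : Finset (Fin k)).offDiag.biUnion fun p =>
        (univ : Finset (Fin k → Fin n × Bool)).filter fun x => (x p.2).1 = (x p.1).1 := by
    intro x hx
    rw [mem_filter] at hx
    obtain ⟨-, j, j', hjj', he⟩ := hx
    rw [mem_biUnion]
    exact ⟨(j, j'), by rw [mem_offDiag]; exact ⟨mem_univ _, mem_univ _, hjj'⟩,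
      by rw [mem_filter]; exact ⟨mem_univ _, he.symm⟩⟩
  have hfib : ∀ p ∈ (univ : Finset (Fin k)).offDiag,
      ((univ : Finset (Fin k → Fin n × Bool)).filter fun x => (x p.2).1 = (x p.1).1).card ≤ 2 * (2 * n) ^ (k - 1) := by
    intro p hp
    rw [mem_offDiag] at hp
    have hinj : Set.InjOn (fun x : Fin k → Fin n × Bool => (Function.update x p.2 ℓ₀, (x p.2).2))
        ↑((univ : Finset (Fin k → Fin n × Bool)).filter fun x => (x p.2).1 = (x p.1).1) := by
      intro x hx y hy hxy
      simp only [coe_filter, mem_univ, true_and, Set.mem_setOf_eq] at hx hy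
      simp only [Prod.mk.injEq] at hxy
      obtain ⟨hupd, hsign⟩ := hxy
      have hoff : ∀ j'' : Fin k, j'' ≠ p.2 → x j'' = y j'' := by
        intro j'' hj''
        have := congr_fun hupd j''
        rwa [Function.update_of_ne hj'', Function.update_of_ne hj''] at this
      funext j''
      by_cases hj'' : j'' = p.2
      · subst hj''
        refine Prod.ext ?_ hsign
        rw [hx, hy]
        exact congr_arg Prod.fst (hoff p.1 hp.2.2)
      · exact hoff j'' hj''
    have hmaps : ∀ x ∈ ((univ : Finset (Fin k → Fin n × Bool)).filter fun x => (x p.2).1 = (x p.1).1),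
        (fun x : Fin k → Fin n × Bool => (Function.update x p.2 ℓ₀, (x p.2).2)) x ∈
          (Fintype.piFinset fun j'' : Fin k => if j'' = p.2 then ({ℓ₀} : Finset (Fin n × Bool)) else univ) ×ˢ
            (univ : Finset Bool) := by
      intro x _
      rw [mem_product]
      refine ⟨?_, mem_univ _⟩
      rw [Fintype.mem_piFinset]
      intro j''
      dsimp only
      split_ifs with h1
      · rw [h1, Function.update_self, mem_singleton]
      · rw [Function.update_of_ne h1]; exact mem_univ _
    have hpi : (Fintype.piFinset fun j'' : Fin k =>
        if j'' = p.2 then ({ℓ₀} : Finset (Fin n × Bool)) else univ).card = (2 * n) ^ (k - 1) := by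
      rw [Fintype.card_piFinset, ← Finset.mul_prod_erase univ _ (mem_univ p.2), if_pos rfl, card_singleton,
        one_mul]
      have hc : ∀ j'' ∈ univ.erase p.2,
          ((if j'' = p.2 then ({ℓ₀} : Finset (Fin n × Bool)) else univ).card) = 2 * n := by
        intro j'' hj''
        rw [mem_erase] at hj''
        rw [if_neg hj''.1, card_univ, Fintype.card_prod, Fintype.card_fin, Fintype.card_bool, mul_comm]
      rw [prod_congr rfl hc, prod_const, card_erase_of_mem (mem_univ _), card_univ, Fintype.card_fin]
    refine (card_le_card_of_injOn _ hmaps hinj).trans (le_of_eq ?_)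
    rw [card_product, hpi, card_univ, Fintype.card_bool, mul_comm]
  refine (card_le_card hsub).trans (card_biUnion_le.trans ?_)
  refine (sum_le_sum hfib).trans (le_of_eq ?_)
  rw [sum_const, smul_eq_mul, offDiag_card, card_univ, Fintype.card_fin]

/-- **Degenerate clauses summed over the instances.** For every clause index `i` (`n ≥ 1`):
`#C·Σ_Φ 1[i degenerate] ≤ (k²-k)·(2·#L^{k-1})·#Ω`. -/
theorem sissU_sum_degenerate_indicator_le (hn : 1 ≤ n) (i : Fin m) :
    (Fintype.card (Fin k → Fin n × Bool) : ℝ) *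
      ∑ Φ : Fin m → Fin k → Fin n × Bool,
        (if ∃ j j' : Fin k, j ≠ j' ∧ (Φ i j).1 = (Φ i j').1 then (1 : ℝ) else 0)
      ≤ ((k * k - k : ℕ) : ℝ) * (2 * (2 * n) ^ (k - 1) : ℕ) * Fintype.card (Fin m → Fin k → Fin n × Bool) := by
  have hrr := Summit.PneNP.PneNP.Cruxes.SolvableImpliesStableSection.Sketch.stub_rerandomize i
    (fun _ : Fin m → Fin k → Fin n × Bool => (0 : ℕ)) (fun _ _ => rfl)
    (fun x _ => if ∃ j j' : Fin k, j ≠ j' ∧ (x j).1 = (x j').1 then (1 : ℝ) else 0)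
  refine (le_of_eq hrr).trans ?_
  rw [sum_const, card_univ, nsmul_eq_mul, sum_boole, mul_comm]
  refine mul_le_mul_of_nonneg_right ?_ (Nat.cast_nonneg _)
  exact_mod_cast sissU_card_degenerate_le (k := k) hn

end Collisions

end Summit.PneNP.PneNP.Theorems
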